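import Summits.Ventures.PercRepro.Night2ShadowContract
import Summits.Ventures.PercRepro.Night2ShadowHull

/-!
# PercRepro — the inductive step of the diagonal shadow form, modulo the selection conjecture (night-2, gen 5)

The three regimes of `NIGHT-2-shadow.md` §8–§9 in one theorem.  For a loopless matroid `M` of rank `q + 2` (`q ≥ 1`) and
a family `𝒜 ⊆ Uq M (q + 2) q`, exactly one of the following holds, and each gives the shadow condition at
`Φ(q + 2, q) = (q + 2)/(q + 1)`:
* R0 — some ground element lies outside every closure: `shadow_card_of_notMem_closure` (no hypothesis);
* R1 — some ground element lies inside every closure: `shadow_card_of_mem_closure` from the shadow conditions of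
  `M ／ {x}` at `(q + 1, q − 1)` and of `M ＼ {x}` at `(q + 2, q)` (the induction hypotheses);
* R2 — the closures cover the ground set with empty intersection: `card_shadow_of_selection` from
  `DirectHullSelection`.
So **`shadowHall_step`**: the induction hypotheses on the two single-element minors and `DirectHullSelection` give
`ShadowHall M (q + 2) q ((q + 2)/(q + 1))` for every loopless `M` of rank `q + 2`.  The wrapper (induction on `(q, #E)`
with truncation to rank `q + 2` and the removal of loops) is the remaining bookkeeping (paper §9(c), §9(f)).
-/

open scoped Matroid

namespace PercRepro.Shadow

open Finset PerFlat ThmH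

variable {α : Type} [DecidableEq α] {M : Matroid α} [M.Finite]

/-- **The inductive step of the diagonal shadow form, modulo `DirectHullSelection`.** -/
theorem shadowHall_step {q : ℕ} (hq : 1 ≤ q) (hM : M.eRank = ((q + 2 : ℕ) : ℕ∞))
    (hloop : ∀ e ∈ M.E, M.Indep {e})
    (IHc : ∀ x ∈ M.E, ShadowHall (M ／ ({x} : Set α)) (q + 1) (q - 1) (((q : ℚ) + 1) / q))
    (IHd : ∀ x ∈ M.E, ShadowHall (M ＼ ({x} : Set α)) (q + 2) q (((q : ℚ) + 2) / (q + 1)))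
    (hsel : DirectHullSelection) :
    ShadowHall M (q + 2) q (((q : ℚ) + 2) / (q + 1)) := by
  intro 𝒜 h𝒜
  rcases 𝒜.eq_empty_or_nonempty with hemp | hne
  · subst hemp
    simp
  by_cases hR0 : ∃ x ∈ gr M, ∀ B ∈ 𝒜, x ∉ clF M B
  · -- regime R0: the e-lemma
    obtain ⟨x, hx, hcl⟩ := hR0
    have := shadow_card_of_notMem_closure h𝒜 hx hcl
    exact_mod_cast this
  by_cases hR1 : ∃ x ∈ gr M, ∀ B ∈ 𝒜, x ∈ clF M B
  · -- regime R1: the contraction regime from the induction hypotheses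
    obtain ⟨x, hx, hcl⟩ := hR1
    have hxE : x ∈ M.E := by rw [← coe_gr]; exact_mod_cast hx
    have := shadow_card_of_mem_closure (hloop x hxE) hq hM h𝒜 hcl (IHc x hxE) (IHd x hxE)
    exact_mod_cast this
  · -- regime R2: the selection conjecture
    push Not at hR0 hR1
    have hcov : ∀ x ∈ gr M, ∃ B ∈ 𝒜, x ∈ clF M B := by
      intro x hx
      obtain ⟨B, hB, hBx⟩ := hR0 x hx
      exact ⟨B, hB, by simpa using hBx⟩
    have hint : ∀ x ∈ gr M, ∃ B ∈ 𝒜, x ∉ clF M B := hR1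
    have := card_shadow_of_selection hsel M hM h𝒜 hne hcov hint
    exact_mod_cast this

end PercRepro.Shadow
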